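import Summits.KontsevichZagierPeriods.KontsevichZagierPeriods.Theses.LinRedNormalForm
import Literature.NumberTheory.Transcendental.MultipleZetaValuesProofs
import Literature.NumberTheory.Transcendental.MultipleZetaDepthTwoProofs

/-!
# Crux `HoffmanIndependence` (stmt-KontsevichZagierPeriods-15045) — negative lemma:
# the ALGEBRAIC strengthening is false

Disprover output (cdisprove cycle 1; workfile `Cruxes/HoffmanIndependence/Disproof.lean`, §A).
`HoffmanIndependence` is ℚ-LINEAR independence of the Hoffman values over all weights. The natural
multiplicative strengthening — algebraic independence of the Hoffman values over `ℚ` — is FALSE already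
in weight 4: `ζ(2)² = (10/3)·ζ(2,2)` (`ζ(2) = π²/6`, `ζ(2,2) = π⁴/120`; in general the product is
governed by the (quasi-)shuffle relations, which rewrite products of Hoffman values as ℚ-combinations
of Hoffman values). So the crux is exactly as strong as it can be in the linear direction
(`AlphabetMutations.lean`: a basis claim) and no stronger in the multiplicative one: the ℚ-algebra
generated by the Hoffman values is the MZV algebra, conjecturally polynomial on LYNDON words in
`{2,3}` (Hoffman), not on all of `{2,3}^×`.
-/

namespace Summit.KontsevichZagierPeriods.HoffmanIndependence.Negative

open Literature.NumberTheory.Transcendental MZV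

/-- **Algebraic independence of the Hoffman values is false**: the polynomial
`X_{(2)}² - (10/3)·X_{(2,2)}` is non-zero and vanishes at the Hoffman values
(`ζ(2)² = π⁴/36 = (10/3)·π⁴/120 = (10/3)·ζ(2,2)`). [folklore] -/
theorem hoffmanIndependence_false_algebraic :
    ¬ AlgebraicIndependent ℚ (fun u : {u : List ℕ // IsHoffman u} => multipleZeta u.1) := by
  classical
  intro h
  rw [algebraicIndependent_iff] at h
  let a : {u : List ℕ // IsHoffman u} := ⟨[2], by decide⟩
  let b : {u : List ℕ // IsHoffman u} := ⟨[2, 2], by decide⟩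
  have hab : a ≠ b := by simp [a, b]
  let p : MvPolynomial {u : List ℕ // IsHoffman u} ℚ :=
    MvPolynomial.X a * MvPolynomial.X a - MvPolynomial.C (10 / 3) * MvPolynomial.X b
  have hp : MvPolynomial.aeval (fun u : {u : List ℕ // IsHoffman u} => multipleZeta u.1) p = 0 := by
    simp only [p, map_sub, map_mul, MvPolynomial.aeval_X, MvPolynomial.aeval_C, a, b,
      multipleZeta_two, multipleZeta_two_two, eq_ratCast]
    push_cast
    ring
  have hp0 := h p hp
  -- evaluate at the rational point `a ↦ 0`, `b ↦ 1` (everything else `0`): `p ↦ -10/3 ≠ 0`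
  have := congrArg (MvPolynomial.eval fun u => if u = b then (1 : ℚ) else 0) hp0
  norm_num [p, hab] at this

end Summit.KontsevichZagierPeriods.HoffmanIndependence.Negative
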